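import Summits.AtomisticToContinuum.Crystallization.Theorems.ChargedEnergyGapRotationGauge
import HarnessLib

/-!
(SPLIT FOR THE 400-LINE CAP by the landing lane, hand-2 g31: this file = part 1 of 2; sequels `…ChargedEnergyGapRotationRepair` import it in a chain; same namespace, all FQNs unchanged.)
# `ChargedEnergyGap` — the ROTATION GAUGE (2/2): stability MODULO ROTATIONS, the re-typed pair (H𝄪ʳ)/(N𝄪ʳ), the gauged Dirichlet credit, the faceless twist
# (cell `decomp-a2c`, lens 3, generation 61, node «RotationGauge», part P-I(2/2); over part P-I(1/2) `…Theorems.ChargedEnergyGapRotationGauge`)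

THE REPAIR (memo g61 §2).  `HarmStableModRot μ₀ P : ∀ β, IsGlobalCocycle P β → ∃ r₀ v, μ₀·Σ_y Dir_y(β − W_{r₀,v}) ≤ Σ_y quad_y(β)`: the cell's
quadratic energy controls the Dirichlet energy of the cocycle MINUS ITS BEST-FITTING INFINITESIMAL ROTATION (`rotField r₀ v` exhausts `so(3)`).
It is WEAKER than the contradictory `HarmStableWith μ₀ P` (`harmStableModRot_of_harmStableWith`, gauge `0`), passes the alarm's witness
(`harmStableModRot_test_rotField`: a rotation gauged by itself has zero Dirichlet energy), and means phonon stability on `Λ_P` plus elastic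
stability with internal relaxation in the range-`2` Dirichlet currency — INSTRUMENTABLE (census ask STAB-61; memo g53 §2's «softest sector
`≈ 0.019`» was already this), TRUE-leaning for the relaxed Lennard-Jones references at the record `μ₀ = 1/100`.

THE RE-TYPED PAIR.  (H𝄪ʳ) `LocalSeamTransferBoundR` = (H𝄪) verbatim with `HarmStableModRot` for `HarmStableWith` — genuinely STRONGER than (H𝄪)
(`localSeamTransferBoundC_of_R`; not reachable by the alarm); (N𝄪ʳ) `LocalSeamReductionR := (H𝄪ʳ) → leaf` — WEAKER than (N𝄪)
(`localSeamReductionR_of_W`) and than the leaf, no longer equivalent to it; ★ glue `farLabelledFloorCoredBudgetW_of_localR` (modus ponens);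
dials; ★★ record cones `chargedEnergyGap_of_localLedgerR` (every `W`, every `ϱ`) and `chargedEnergyGap_of_maxCoverLocalLedgerR_record`
(`ϱ = 160`; RECORD-DESIGNATE of generation 61, same dials `(μ₀, τ, λ, b₀, r_S, C_T, ϱχ, Cχ) = (1/100, 3/100, 1/2, 2/5, 3, 1/(3·10⁶), 80, 10⁻⁵)`),
and the consistency cone `chargedEnergyGap_of_localLedgerR_of_W` recovering GEN 56L.

THE CREDIT FORM (critic row 1104 (c2)(i)).  (H𝄪♯ʳ)(κ_D) `LocalSeamTransferCreditR`: the same lower bound PLUS `κ_D·creditL`, the instance-weighted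
(`χ·w`) excision-aware range-`2` Dirichlet energy of the Volterra field MINUS A ROTATION GAUGE chosen per application (`∃ r₀ v`; an
un-gauged credit is refuted by a small rotation, on which `modelFarL = 0`).  STRONGER than (H𝄪ʳ) for `κ_D ≥ 0`, equal to it at `κ_D = 0`
(`localSeamTransferCreditR_zero_iff`), antitone in `κ_D`; the reduction (N𝄪♯ʳ)(κ_D) `LocalSeamCreditReductionR` is WEAKER than (N𝄪ʳ), monotone
in `κ_D`; glue; ★★ cone `chargedEnergyGap_of_maxCoverCreditLedgerR_record` at the record CREDIT DIAL `κ_D = λμ₀/4 = 1/800` (a quarter of the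
certified coercivity is booked as credit, three quarters stay with the transfer: C11-29 and χCOST-56 keep margins `×1.6` / `×1.4`,
`record_credit_margins`; `λμ₀/2 = 1/400` would break χCOST's upper table value — census event C11-61/χCOST-61 decides the designate).

THE FACELESS TWIST (critic row 1104 (K-iv); §4, memo §3).  A log-twist column `u = 2s·r·ln(r/a)·e_φ`, `a ≤ r ≤ L`, strain `s = 0.9 %`, no charged
site anywhere.  Swing tolerance of one instance `2(τ − s) = 0.042` ⇒ radial ratio `10.3` per class, innermost servable radius `7.8` (plateau
`40` + zone `40` pinned by `ϱχ = 80`).  (α) `a ≥ 8`: classes + zones, allowances `≤ 0.58` (`L/a = 28`) / `≤ 3.7` (`L/a = 150`) per unit length,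
booked credit `≥ 1.67` / `≥ 57` — SELF-PAID at `κ_D = 1/800` (`record_twist_alpha`).  (β) `a < 8`: the core `r < 7.8` is EXCISED (`256–384` priced
sites per unit length); payable from the column's own credit iff `L ≳ 100·√(10³·C_H)`: at the hole price `C_H = 10⁻³` (flat-boundary
cancellation by zero stress) for `L ≳ 100`, NOT for the thin column `L = 28` (`record_twist_beta_thin/_wide`): a METHOD GAP of `≤ 0.3–0.4` per
unit length of thin steep twist — its true excess `≈ 16` per unit length is booked at `0.2 %` by the `μ₀`-floor credit.  Levers (memo §3, asks
HOLE-61 / SMOOTH-61): the smooth-field modulus `μ₁ ≈ 0.3 ≫ μ₀` (a two-scale stability hypothesis would raise the credit `×30`), or direct booking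
of clean sheared matter.  (γ) the Guard does not exclude the family (`record_twist_guard`).  BENDING: the gently bent thick slab of BEND-60 is
paid by the credit at the floor (`record_bend_thick`), so BEND-60 (a) is no longer load-bearing for `h ≥ 200`.

§3 `HarmStableModRot`, WEAKER-than-typed, witness defused, antitone; (H𝄪ʳ), (H𝄪ʳ) ⟹ (H𝄪), dials; (N𝄪ʳ), glue, WEAKER, dials; `dirichletSiteX`,
`creditL ≥ 0`, (H𝄪♯ʳ)(κ_D), ⟹ (H𝄪ʳ), antitone, `κ_D = 0` iff; (N𝄪♯ʳ)(κ_D), glue, WEAKER, monotone; record numerals; ★★ three record cones +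
consistency.  §4 (K-iv) numerals (α)/(β)/(γ), bending.

TAGS.  REPAIR (pieces UNDECIDED→TRUE-leaning, INSTRUMENTABLE: STAB-61, C11-61/χCOST-61, HOLE-61, SMOOTH-61, POLY-61) · glue / dials / cones /
numerals PROVED · record-designate pair ((H𝄪ʳ), (N𝄪ʳ)) at `ϱ = 160`; alternative designate ((H𝄪♯ʳ), (N𝄪♯ʳ)) at `κ_D = 1/800`. -/

noncomputable section
open scoped Classical
open Literature.MathematicalPhysics.StatisticalMechanics
open Literature.Geometry.DiscreteGeometry
open Summit.AtomisticToContinuum.Crystallization.Theses.PricedLinkCensus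
open Summit.AtomisticToContinuum.Crystallization.Theorems.ChargedEnergyGapNegative

namespace Summit.AtomisticToContinuum.Crystallization.Theorems.ChargedEnergyGapChartDial

/-! ## §3 The repair: stability MODULO ROTATIONS, the re-typed pair (H𝄪ʳ)/(N𝄪ʳ), the rotation-gauged Dirichlet credit (H𝄪♯ʳ)/(N𝄪♯ʳ) -/

section Repair

/-- **HARMONIC STABILITY MODULO ROTATIONS with margin `μ₀`** (the repair of `HarmStableWith`): for every global cocycle `β` there is a rotation
gauge `(r₀, v)` such that `μ₀·Σ_y Dir_y(β − W_{r₀,v}) ≤ Σ_y quad_y(β)` — the cell's quadratic energy controls the range-`2` Dirichlet energy of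
the field MINUS ITS BEST-FITTING INFINITESIMAL ROTATION (`rotField r₀ v`, a `3`-parameter family exhausting `so(3)`).  This is phonon
stability on the supercell `Λ_P` plus elastic stability with internal relaxation, in the Dirichlet currency `Σ_{d ≤ 2}‖·‖²` (`54`
neighbours per site in relaxed fcc/hcp): INSTRUMENTABLE (census ask STAB-61), TRUE-leaning for the relaxed Lennard-Jones references at the
record `μ₀ = 1/100` (memo g53 §2: softest sampled sector `≈ 0.019`), and no longer refuted by rotations (`harmStableModRot_test_rotField`). -/
def HarmStableModRot (μ₀ : ℝ) (P : PeriodicConfiguration 3) : Prop :=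
  ∀ β : E3 → E3 → E3, IsGlobalCocycle P β →
    ∃ r₀ v : E3, μ₀ * (∑ y ∈ P.motif, dirichletSite (gaugedField β r₀ v) P y) ≤ ∑ y ∈ P.motif, quadSite β P ∅ y

variable {P : PeriodicConfiguration 3} {μ₀ : ℝ}

/-- ★ The repaired hypothesis is WEAKER than the typed one (gauge `(0, 0)`) — so every piece re-typed over it is STRONGER. -/
theorem harmStableModRot_of_harmStableWith (h : HarmStableWith μ₀ P) : HarmStableModRot μ₀ P :=
  fun β hβ => ⟨0, 0, by rw [gaugedField_zero]; exact h β hβ⟩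

/-- ★ The alarm's witness is DEFUSED: a rotation cocycle passes the repaired test with its own gauge at a stress-free reference (both sides
vanish) — where it FAILED the typed test at every `μ₀ > 0`. -/
theorem harmStableModRot_test_rotField (hS : IsStressFree P) (r₀ v : E3) :
    ∃ r₁ v₁ : E3, μ₀ * (∑ y ∈ P.motif, dirichletSite (gaugedField (rotField r₀ v) r₁ v₁) P y) ≤
      ∑ y ∈ P.motif, quadSite (rotField r₀ v) P ∅ y :=
  ⟨r₀, v, by rw [gaugedField_rotField_self, sum_quadSite_rotField_eq_zero hS]; simp [dirichletSite]⟩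

/-- Stability modulo rotations is antitone in the margin. -/
theorem HarmStableModRot.anti {μ₀' : ℝ} (hμ : μ₀' ≤ μ₀) (h : HarmStableModRot μ₀ P) : HarmStableModRot μ₀' P := by
  intro β hβ
  obtain ⟨r₀, v, hle⟩ := h β hβ
  have h0 : 0 ≤ ∑ y ∈ P.motif, dirichletSite (gaugedField β r₀ v) P y :=
    Finset.sum_nonneg fun y _ => tsum_nonneg fun _ => sq_nonneg _
  exact ⟨r₀, v, (mul_le_mul_of_nonneg_right hμ h0).trans hle⟩

/-- (critic row 1109 (3)(d) M3) ONE GLOBAL GAUGE DOES NOT ABSORB TWO LOCAL ROTATIONS: a field equal to the rotation `W = e₁ ⊗ e₀ − e₀ ⊗ e₁` on one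
bond of direction `e₀` and to `−W` on another keeps a non-zero gauged value on one of them, whatever the global gauge `(r₀, v)` — so
`HarmStableModRot` is NOT the statement «`β` is a global rotation plus a `μ₀`-small remainder»; position-dependent rotations (bent slabs, twist,
the two variants of a twin) keep their Dirichlet mass up to the ONE best global fit. -/
theorem twoRotations_not_gauged (r₀ v y y' : E3) :
    gaugedField (rotField (EuclideanSpace.single 0 1) (EuclideanSpace.single 1 1)) r₀ v y (y + EuclideanSpace.single 0 1) ≠ 0 ∨
      gaugedField (fun p q => -rotField (EuclideanSpace.single 0 1) (EuclideanSpace.single 1 1) p q) r₀ v y'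
        (y' + EuclideanSpace.single 0 1) ≠ 0 := by
  by_contra h
  push Not at h
  obtain ⟨h1, h2⟩ := h
  have hW : rotField (EuclideanSpace.single 0 1) (EuclideanSpace.single 1 1) y (y + EuclideanSpace.single 0 1) =
      EuclideanSpace.single (1 : Fin 3) (1 : ℝ) := by
    simp [rotField, EuclideanSpace.inner_single_right]
  have hW' : rotField (EuclideanSpace.single 0 1) (EuclideanSpace.single 1 1) y' (y' + EuclideanSpace.single 0 1) =
      EuclideanSpace.single (1 : Fin 3) (1 : ℝ) := by
    simp [rotField, EuclideanSpace.inner_single_right]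
  have hg : rotField r₀ v y (y + EuclideanSpace.single 0 1) = rotField r₀ v y' (y' + EuclideanSpace.single 0 1) := by
    simp [rotField]
  simp only [gaugedField, hW, hW', hg] at h1 h2
  have hsum : (2 : ℝ) • EuclideanSpace.single (1 : Fin 3) (1 : ℝ) = 0 := by
    have := congrArg₂ (· - ·) h1 h2
    simp only [sub_zero] at this
    rw [two_smul, ← this]; abel
  have h3 := congrArg (fun z : E3 => z 1) hsum
  norm_num at h3

variable (s lam ℓ μ₀ τ lamQ ϱ b₀ r_S C_T ϱχ Cχ : ℝ)

/-- piece LOCAL-TRANSFERʳ(`C_T`, `Cχ`, `ϱχ`) · **THE RE-TYPED (H𝄪)**: the localised seam transfer bound VERBATIM, with the stability hypothesis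
`HarmStableWith μ₀ P` replaced by `HarmStableModRot μ₀ P` · genuinely STRONGER than (H𝄪) (`localSeamTransferBoundC_of_R`) and NOT provable by the
alarm · UNDECIDED→TRUE-leaning at the record (the census engines C10/C11/C13/C15/C16 (b)/χCOST never used the typed predicate: their «stability»
was already modulo rigid motions) · INSTRUMENTABLE (as (H𝄪), plus STAB-61 for the hypothesis, POLY-61 for per-layer residual stress of polytype
references against the rotation test field) · ATTACKABLE-M+.  Why it might fail: everything listed under (H𝄪) (part P-D), now for real. -/
def LocalSeamTransferBoundR : Prop :=
  ∃ C_H : ℝ, 0 ≤ C_H ∧ ∀ (P : PeriodicConfiguration 3) (C X : Set E3) (β₀ : E3 → E3 → E3) (k : ℕ) (S : Fin k → CutPiece)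
    (m : ℕ) (D : Fin m → Set E3) (σ : Fin m → Bool),
    IsSeparatedRef s P → IsLabelledRef lam ℓ P → IsForceFree P → IsStressFree P → HarmStableModRot μ₀ P →
    IsInvariantSet P C → IsInvariantSet P X → IsGlobalCocycle P β₀ → IsSeamSystem b₀ r_S P S →
    SmallStrain τ P X (volterraField P S β₀) → (∀ i, IsInvariantSet P (D i)) →
      -(C_T * shellMassL ϱχ D σ P X ϱ C) - Cχ * transMassL ϱχ D σ P X ϱ C - C_H * (pricedNearCountL ϱχ D σ P X ϱ C : ℝ) ≤
        modelFarL ϱχ D σ (volterraField P S β₀) P X lamQ ϱ C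

variable {s lam ℓ μ₀ τ lamQ ϱ b₀ r_S C_T ϱχ Cχ}

/-- ★ **(H𝄪ʳ) ⟹ (H𝄪)** (hypothesis weakening) — the converse is the content the alarm removed. -/
theorem localSeamTransferBoundC_of_R (h : LocalSeamTransferBoundR s lam ℓ μ₀ τ lamQ ϱ b₀ r_S C_T ϱχ Cχ) :
    LocalSeamTransferBoundC s lam ℓ μ₀ τ lamQ ϱ b₀ r_S C_T ϱχ Cχ := by
  obtain ⟨C_H, hH, h⟩ := h
  exact ⟨C_H, hH, fun P C X β₀ k S m D σ h1 h2 h3 h4 h5 h6 h7 h8 h9 h10 h11 =>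
    h P C X β₀ k S m D σ h1 h2 h3 h4 (harmStableModRot_of_harmStableWith h5) h6 h7 h8 h9 h10 h11⟩

/-- (H𝄪ʳ) is monotone in the stability margin it assumes … -/
theorem LocalSeamTransferBoundR.mono_mu {μ₀' : ℝ} (hμ : μ₀ ≤ μ₀') (h : LocalSeamTransferBoundR s lam ℓ μ₀ τ lamQ ϱ b₀ r_S C_T ϱχ Cχ) :
    LocalSeamTransferBoundR s lam ℓ μ₀' τ lamQ ϱ b₀ r_S C_T ϱχ Cχ := by
  obtain ⟨C_H, hH, h⟩ := h
  exact ⟨C_H, hH, fun P C X β₀ k S m D σ h1 h2 h3 h4 h5 h6 h7 h8 h9 h10 h11 =>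
    h P C X β₀ k S m D σ h1 h2 h3 h4 (h5.anti hμ) h6 h7 h8 h9 h10 h11⟩

/-- … in the transfer constant `C_T` … -/
theorem LocalSeamTransferBoundR.mono_CT {C_T' : ℝ} (hC : C_T ≤ C_T') (h : LocalSeamTransferBoundR s lam ℓ μ₀ τ lamQ ϱ b₀ r_S C_T ϱχ Cχ) :
    LocalSeamTransferBoundR s lam ℓ μ₀ τ lamQ ϱ b₀ r_S C_T' ϱχ Cχ := by
  obtain ⟨C_H, hH, h⟩ := h
  refine ⟨C_H, hH, fun P C X β₀ k S m D σ h1 h2 h3 h4 h5 h6 h7 h8 h9 h10 h11 => le_trans ?_ (h P C X β₀ k S m D σ h1 h2 h3 h4 h5 h6 h7 h8 h9 h10 h11)⟩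
  have := shellMassL_nonneg (ϱχ := ϱχ) (D := D) (σ := σ) P X ϱ C
  nlinarith

/-- … and in the transition constant `Cχ`. -/
theorem LocalSeamTransferBoundR.mono_Cchi {Cχ' : ℝ} (hC : Cχ ≤ Cχ') (h : LocalSeamTransferBoundR s lam ℓ μ₀ τ lamQ ϱ b₀ r_S C_T ϱχ Cχ) :
    LocalSeamTransferBoundR s lam ℓ μ₀ τ lamQ ϱ b₀ r_S C_T ϱχ Cχ' := by
  obtain ⟨C_H, hH, h⟩ := h
  refine ⟨C_H, hH, fun P C X β₀ k S m D σ h1 h2 h3 h4 h5 h6 h7 h8 h9 h10 h11 => le_trans ?_ (h P C X β₀ k S m D σ h1 h2 h3 h4 h5 h6 h7 h8 h9 h10 h11)⟩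
  have := transMassL_nonneg (ϱχ := ϱχ) (D := D) (σ := σ) P X ϱ C
  nlinarith

variable (s lam ℓ μ₀ τ lamQ ϱ b₀ r_S C_T ϱχ Cχ)
variable {θ ε R r η L δ L' : ℝ} (W : CoreWeights θ ε R r η L δ L' ϱ) (c₁ ρ₀ B₀ : ℝ)

/-- piece LOCAL-REDUCTIONʳ_W · **THE RE-TYPED (N𝄪)**: the re-typed localised seam transfer bound implies the budget far leaf · WEAKER than
(N𝄪) (`localSeamReductionR_of_W`) and than the leaf (`localSeamReductionR_of_budget`) · no longer EQUIVALENT to the leaf by the alarm · UNDECIDED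
(TRUE-leaning with the leaf for the max cover) · ATTACKABLE-L.  Proof obligations as listed under (N𝄪) (part P-D: (ε) charted-charged coherent
misoriented walls; the c-fraction of transition zones in heavily faulted matter; the orientation-class geometry over `LabelledWithin`), PLUS:
the prover must now CERTIFY `HarmStableModRot (1/100)` for its references (STAB-61), and (ζ) STEEP FACELESS TWIST CORES (§4: rotation
swing `> 2(τ − s) = 0.042` within one plateau-plus-zone `80`, i.e. log-twist columns of inner radius `a ≲ 8`: excised, `≈ 268` priced sites per
unit length, payable from the column's own booked energy only in the credit form (H𝄪♯ʳ) and only for outer radius `L ≳ 82` at `C_H = 10⁻³`). -/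
def LocalSeamReductionR : Prop :=
  LocalSeamTransferBoundR s lam ℓ μ₀ τ lamQ ϱ b₀ r_S C_T ϱχ Cχ → FarLabelledFloorCoredBudgetW W c₁ s ρ₀ lam ℓ B₀

variable {s lam ℓ μ₀ τ lamQ ϱ b₀ r_S C_T ϱχ Cχ W c₁ ρ₀ B₀}

/-- ★ **THE SPLIT** (glue, proved; bridge split by modus ponens): LOCAL-TRANSFERʳ ∧ LOCAL-REDUCTIONʳ_W ⟹ CB-FAR_W|cored,`B₀`. -/
theorem farLabelledFloorCoredBudgetW_of_localR (hS : LocalSeamTransferBoundR s lam ℓ μ₀ τ lamQ ϱ b₀ r_S C_T ϱχ Cχ)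
    (hN : LocalSeamReductionR s lam ℓ μ₀ τ lamQ ϱ b₀ r_S C_T ϱχ Cχ W c₁ ρ₀ B₀) : FarLabelledFloorCoredBudgetW W c₁ s ρ₀ lam ℓ B₀ :=
  hN hS

/-- ★ WEAKER: (N𝄪) ⟹ (N𝄪ʳ) (the reduction's hypothesis got stronger). -/
theorem localSeamReductionR_of_W (h : LocalSeamReductionW s lam ℓ μ₀ τ lamQ ϱ b₀ r_S C_T ϱχ Cχ W c₁ ρ₀ B₀) :
    LocalSeamReductionR s lam ℓ μ₀ τ lamQ ϱ b₀ r_S C_T ϱχ Cχ W c₁ ρ₀ B₀ :=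
  fun hS => h (localSeamTransferBoundC_of_R hS)

/-- WEAKER: the budget far leaf implies (N𝄪ʳ) at every dial. -/
theorem localSeamReductionR_of_budget (h : FarLabelledFloorCoredBudgetW W c₁ s ρ₀ lam ℓ B₀) :
    LocalSeamReductionR s lam ℓ μ₀ τ lamQ ϱ b₀ r_S C_T ϱχ Cχ W c₁ ρ₀ B₀ :=
  fun _ => h

/-- (N𝄪ʳ) is antitone in the stability margin (the reduction from the transfer bound at a larger assumed margin is the stronger task) … -/
theorem LocalSeamReductionR.anti_mu {μ₀' : ℝ} (hμ : μ₀ ≤ μ₀') (h : LocalSeamReductionR s lam ℓ μ₀' τ lamQ ϱ b₀ r_S C_T ϱχ Cχ W c₁ ρ₀ B₀) :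
    LocalSeamReductionR s lam ℓ μ₀ τ lamQ ϱ b₀ r_S C_T ϱχ Cχ W c₁ ρ₀ B₀ :=
  fun hS => h (hS.mono_mu hμ)

/-- … antitone in `C_T` and `Cχ`, monotone in the leaf's dials. -/
theorem LocalSeamReductionR.anti_CT {C_T' : ℝ} (hC : C_T' ≤ C_T) (h : LocalSeamReductionR s lam ℓ μ₀ τ lamQ ϱ b₀ r_S C_T ϱχ Cχ W c₁ ρ₀ B₀) :
    LocalSeamReductionR s lam ℓ μ₀ τ lamQ ϱ b₀ r_S C_T' ϱχ Cχ W c₁ ρ₀ B₀ :=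
  fun hS => h (hS.mono_CT hC)

/-- `LocalSeamReductionR.anti_Cchi` (docstring added by the landing lane; see the module docstring). [formal bookkeeping] -/
theorem LocalSeamReductionR.anti_Cchi {Cχ' : ℝ} (hC : Cχ' ≤ Cχ) (h : LocalSeamReductionR s lam ℓ μ₀ τ lamQ ϱ b₀ r_S C_T ϱχ Cχ W c₁ ρ₀ B₀) :
    LocalSeamReductionR s lam ℓ μ₀ τ lamQ ϱ b₀ r_S C_T ϱχ Cχ' W c₁ ρ₀ B₀ :=
  fun hS => h (hS.mono_Cchi hC)

/-- `LocalSeamReductionR.mono_c` (docstring added by the landing lane; see the module docstring). [formal bookkeeping] -/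
theorem LocalSeamReductionR.mono_c {c₁' B₀' : ℝ} (hc : c₁ ≤ c₁') (hB : B₀' ≤ B₀)
    (h : LocalSeamReductionR s lam ℓ μ₀ τ lamQ ϱ b₀ r_S C_T ϱχ Cχ W c₁ ρ₀ B₀) :
    LocalSeamReductionR s lam ℓ μ₀ τ lamQ ϱ b₀ r_S C_T ϱχ Cχ W c₁' ρ₀ B₀' :=
  fun hS => ((h hS).mono W hc).anti W hB

/-! ### The rotation-gauged Dirichlet CREDIT (critic row 1104 (c2)(i)) -/

/-- The EXCISION-AWARE range-`2` Dirichlet site energy: non-excised neighbours only (an excised neighbour carries no strain bound). -/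
def dirichletSiteX (β : E3 → E3 → E3) (P : PeriodicConfiguration 3) (X : Set E3) (y : E3) : ℝ :=
  ∑' z : {z : E3 // z ∈ P.points ∧ z ∉ X ∧ z ≠ y ∧ dist y z ≤ 2}, ‖β y (z : E3)‖ ^ 2

/-- `dirichletSiteX_nonneg` (docstring added by the landing lane; see the module docstring). [formal bookkeeping] -/
theorem dirichletSiteX_nonneg (β : E3 → E3 → E3) (P : PeriodicConfiguration 3) (X : Set E3) (y : E3) : 0 ≤ dirichletSiteX β P X y :=
  tsum_nonneg fun _ => sq_nonneg _

/-- The **LOCALISED DIRICHLET CREDIT** of a bond field: `Σ_{y ∈ motif ∖ X} χ(y)·w_C(y)·Dir_y^X(β)` with the instance's weights `χ·w`. -/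
def creditL (ϱχ : ℝ) {m : ℕ} (D : Fin m → Set E3) (σ : Fin m → Bool) (β : E3 → E3 → E3) (P : PeriodicConfiguration 3) (X : Set E3)
    (ϱ : ℝ) (C : Set E3) : ℝ :=
  ∑ y ∈ P.motif, if y ∈ X then 0 else localFactor ϱχ D σ y * (profileWeight ϱ C y * dirichletSiteX β P X y)

/-- `creditL_nonneg` (docstring added by the landing lane; see the module docstring). [formal bookkeeping] -/
theorem creditL_nonneg (ϱχ : ℝ) {m : ℕ} (D : Fin m → Set E3) (σ : Fin m → Bool) (β : E3 → E3 → E3) (P : PeriodicConfiguration 3)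
    (X : Set E3) (ϱ : ℝ) (C : Set E3) : 0 ≤ creditL ϱχ D σ β P X ϱ C :=
  Finset.sum_nonneg fun y _ => by
    split_ifs
    · exact le_rfl
    · exact mul_nonneg (localFactor_nonneg _ _ _ _) (mul_nonneg (profileWeight_nonneg _ _ _) (dirichletSiteX_nonneg _ _ _ _))

/-- piece LOCAL-TRANSFER♯ʳ(`C_T`, `Cχ`, `ϱχ`, `κ_D`) · **THE CREDIT FORM** of the re-typed transfer bound: the same lower bound PLUS a booked credit
`κ_D·Σ χ·w·Dir^X(β − W)` for SOME rotation gauge `W = W_{r₀,v}` per application (an un-gauged credit would be refuted by `β` = a small rotation: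
`modelFarL = 0 <` credit) · STRONGER than (H𝄪ʳ) for `κ_D ≥ 0` (`localSeamTransferBoundR_of_credit`; at `κ_D = 0` the two coincide,
`localSeamTransferCreditR_zero_iff`) · UNDECIDED→TRUE-leaning at the record `κ_D = λμ₀/4 = 1/800` (three quarters of the certified coercivity
stay with the transfer: C11-29's `7.8·10⁻⁸/λ` per shell site becomes `2.1·10⁻⁷ ≤ C_T = 3.3·10⁻⁷`, χCOST's `c(40) ≤ 5.3·10⁻⁶` becomes `7.1·10⁻⁶ ≤ Cχ =
10⁻⁵`, `record_credit_margins`; census event C11-61/χCOST-61 at coercivity factor `3/4`) · INSTRUMENTABLE · ATTACKABLE-M+.  The credit is the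
typed payer of BENDING and of gentle TWIST (§4): `κ_D·90·s²` per site of local strain `s` (fcc/hcp, `54` neighbours, `Σ r_⊥² = 90.5`), rotation-blind. -/
def LocalSeamTransferCreditR (s lam ℓ μ₀ τ lamQ ϱ b₀ r_S C_T ϱχ Cχ κ_D : ℝ) : Prop :=
  ∃ C_H : ℝ, 0 ≤ C_H ∧ ∀ (P : PeriodicConfiguration 3) (C X : Set E3) (β₀ : E3 → E3 → E3) (k : ℕ) (S : Fin k → CutPiece)
    (m : ℕ) (D : Fin m → Set E3) (σ : Fin m → Bool),
    IsSeparatedRef s P → IsLabelledRef lam ℓ P → IsForceFree P → IsStressFree P → HarmStableModRot μ₀ P →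
    IsInvariantSet P C → IsInvariantSet P X → IsGlobalCocycle P β₀ → IsSeamSystem b₀ r_S P S →
    SmallStrain τ P X (volterraField P S β₀) → (∀ i, IsInvariantSet P (D i)) →
      ∃ r₀ v : E3,
        -(C_T * shellMassL ϱχ D σ P X ϱ C) - Cχ * transMassL ϱχ D σ P X ϱ C - C_H * (pricedNearCountL ϱχ D σ P X ϱ C : ℝ) +
            κ_D * creditL ϱχ D σ (gaugedField (volterraField P S β₀) r₀ v) P X ϱ C ≤
          modelFarL ϱχ D σ (volterraField P S β₀) P X lamQ ϱ C

/-- ★ **(H𝄪♯ʳ)(κ_D) ⟹ (H𝄪ʳ)** for `κ_D ≥ 0` (drop the non-negative credit). -/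
theorem localSeamTransferBoundR_of_credit {κ_D : ℝ} (hκ : 0 ≤ κ_D) (h : LocalSeamTransferCreditR s lam ℓ μ₀ τ lamQ ϱ b₀ r_S C_T ϱχ Cχ κ_D) :
    LocalSeamTransferBoundR s lam ℓ μ₀ τ lamQ ϱ b₀ r_S C_T ϱχ Cχ := by
  obtain ⟨C_H, hH, h⟩ := h
  refine ⟨C_H, hH, fun P C X β₀ k S m D σ h1 h2 h3 h4 h5 h6 h7 h8 h9 h10 h11 => ?_⟩
  obtain ⟨r₀, v, hle⟩ := h P C X β₀ k S m D σ h1 h2 h3 h4 h5 h6 h7 h8 h9 h10 h11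
  have hc := mul_nonneg hκ (creditL_nonneg ϱχ D σ (gaugedField (volterraField P S β₀) r₀ v) P X ϱ C)
  linarith

/-- The credit form is antitone in `κ_D` … -/
theorem LocalSeamTransferCreditR.anti_kappa {κ_D κ_D' : ℝ} (hκ : κ_D' ≤ κ_D)
    (h : LocalSeamTransferCreditR s lam ℓ μ₀ τ lamQ ϱ b₀ r_S C_T ϱχ Cχ κ_D) :
    LocalSeamTransferCreditR s lam ℓ μ₀ τ lamQ ϱ b₀ r_S C_T ϱχ Cχ κ_D' := by
  obtain ⟨C_H, hH, h⟩ := h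
  refine ⟨C_H, hH, fun P C X β₀ k S m D σ h1 h2 h3 h4 h5 h6 h7 h8 h9 h10 h11 => ?_⟩
  obtain ⟨r₀, v, hle⟩ := h P C X β₀ k S m D σ h1 h2 h3 h4 h5 h6 h7 h8 h9 h10 h11
  have hc := mul_le_mul_of_nonneg_right hκ (creditL_nonneg ϱχ D σ (gaugedField (volterraField P S β₀) r₀ v) P X ϱ C)
  exact ⟨r₀, v, by linarith⟩

/-- … and at `κ_D = 0` it IS the re-typed transfer bound. -/
theorem localSeamTransferCreditR_zero_iff :
    LocalSeamTransferCreditR s lam ℓ μ₀ τ lamQ ϱ b₀ r_S C_T ϱχ Cχ 0 ↔ LocalSeamTransferBoundR s lam ℓ μ₀ τ lamQ ϱ b₀ r_S C_T ϱχ Cχ := by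
  refine ⟨localSeamTransferBoundR_of_credit le_rfl, fun h => ?_⟩
  obtain ⟨C_H, hH, h⟩ := h
  refine ⟨C_H, hH, fun P C X β₀ k S m D σ h1 h2 h3 h4 h5 h6 h7 h8 h9 h10 h11 => ⟨0, 0, ?_⟩⟩
  have key := h P C X β₀ k S m D σ h1 h2 h3 h4 h5 h6 h7 h8 h9 h10 h11
  rw [zero_mul, add_zero]
  exact key

/-- piece LOCAL-CREDIT-REDUCTIONʳ_W(`κ_D`) · the reduction from the credit form · WEAKER than (N𝄪ʳ) for `κ_D ≥ 0` (`localSeamCreditReductionR_of_R`)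
· the designated home of the BENDING / TWIST payers of critic row 1104 (c2), (K-iv). -/
def LocalSeamCreditReductionR (s lam ℓ μ₀ τ lamQ ϱ b₀ r_S C_T ϱχ Cχ κ_D : ℝ) {θ ε R r η L δ L' : ℝ} (W : CoreWeights θ ε R r η L δ L' ϱ)
    (c₁ ρ₀ B₀ : ℝ) : Prop :=
  LocalSeamTransferCreditR s lam ℓ μ₀ τ lamQ ϱ b₀ r_S C_T ϱχ Cχ κ_D → FarLabelledFloorCoredBudgetW W c₁ s ρ₀ lam ℓ B₀

/-- ★ **THE CREDIT SPLIT** (glue): LOCAL-TRANSFER♯ʳ(κ_D) ∧ LOCAL-CREDIT-REDUCTIONʳ_W(κ_D) ⟹ CB-FAR_W|cored,`B₀`. -/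
theorem farLabelledFloorCoredBudgetW_of_creditR {κ_D : ℝ} (hS : LocalSeamTransferCreditR s lam ℓ μ₀ τ lamQ ϱ b₀ r_S C_T ϱχ Cχ κ_D)
    (hN : LocalSeamCreditReductionR s lam ℓ μ₀ τ lamQ ϱ b₀ r_S C_T ϱχ Cχ κ_D W c₁ ρ₀ B₀) : FarLabelledFloorCoredBudgetW W c₁ s ρ₀ lam ℓ B₀ :=
  hN hS

/-- ★ WEAKER: (N𝄪ʳ) ⟹ (N𝄪♯ʳ)(κ_D) for `κ_D ≥ 0`. -/
theorem localSeamCreditReductionR_of_R {κ_D : ℝ} (hκ : 0 ≤ κ_D) (h : LocalSeamReductionR s lam ℓ μ₀ τ lamQ ϱ b₀ r_S C_T ϱχ Cχ W c₁ ρ₀ B₀) :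
    LocalSeamCreditReductionR s lam ℓ μ₀ τ lamQ ϱ b₀ r_S C_T ϱχ Cχ κ_D W c₁ ρ₀ B₀ :=
  fun hS => h (localSeamTransferBoundR_of_credit hκ hS)

/-- WEAKER: the leaf implies the credit reduction at every dial. -/
theorem localSeamCreditReductionR_of_budget {κ_D : ℝ} (h : FarLabelledFloorCoredBudgetW W c₁ s ρ₀ lam ℓ B₀) :
    LocalSeamCreditReductionR s lam ℓ μ₀ τ lamQ ϱ b₀ r_S C_T ϱχ Cχ κ_D W c₁ ρ₀ B₀ :=
  fun _ => h

/-- The credit reduction is monotone in `κ_D` (more credit, easier reduction). -/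
theorem LocalSeamCreditReductionR.mono_kappa {κ_D κ_D' : ℝ} (hκ : κ_D ≤ κ_D')
    (h : LocalSeamCreditReductionR s lam ℓ μ₀ τ lamQ ϱ b₀ r_S C_T ϱχ Cχ κ_D W c₁ ρ₀ B₀) :
    LocalSeamCreditReductionR s lam ℓ μ₀ τ lamQ ϱ b₀ r_S C_T ϱχ Cχ κ_D' W c₁ ρ₀ B₀ :=
  fun hS => h (hS.anti_kappa hκ)

/-- RECORD numeral of the credit dial: `κ_D = λ·μ₀/4 = 1/800`, and the two transfer calibrations keep their margins at coercivity factor `3/4`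
(C11-29: `(4/3)·1.56·10⁻⁷ < C_T`; χCOST-56 upper table value: `(4/3)·5.3·10⁻⁶ < Cχ`). -/
theorem record_credit_margins : (1 / 800 : ℝ) = (1 / 2) * (1 / 100) / 4 ∧
    (4 / 3) * (156 / 1000000000 : ℝ) < 1 / 3000000 ∧ (4 / 3) * (53 / 10000000 : ℝ) < 1 / 100000 := by norm_num

/-! ### Record cones over the repaired pieces -/

section Record

/-- ★★ **THE TEN-LEAF RECORD CONE FOR EVERY WEIGHT SYSTEM, REPAIRED**: `ChargeRecount · IP_G · FCP_G · CCP_G · REG-BALL_W · LABEL_W ·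
SHELL-BUDGET_W(10⁵) · LOCAL-TRANSFERʳ(1/(3·10⁶), 10⁻⁵, 80) · LOCAL-REDUCTIONʳ_W · P_G ⟹ ChargedEnergyGap` at the record dials, any `ϱ`, any `W`. -/
theorem chargedEnergyGap_of_localLedgerR {ϱ : ℝ} (W : CoreWeights (3 / 20) (1 / 10) (6 / 5) 10 (1 / 100) 40 (1 / 10) 40 ϱ)
    (hF : ChargeRecount)
    (hIP : ImprovablePricingG (3 / 20) (1 / 10) (6 / 5) 10 (1 / 100) (3 / 5))
    (hFCP : FrustratedCorePricingG (3 / 20) (1 / 10) (6 / 5) 10 (1 / 100) 40 (3 / 5))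
    (hCCP : CoherentCorePricingG (3 / 20) (1 / 10) (6 / 5) 10 (1 / 100) 40 (1 / 10) 40 (3 / 5))
    (hB : CoreBallRegularPricingW W (1 / 20) (3 / 5) 10 fun _ _ => True)
    (hLab : CleanLabellingW W (3 / 5) 10 (1 / 3) 3)
    (hSB : ShellBudgetW W (3 / 5) 100000)
    (hS : LocalSeamTransferBoundR (3 / 5) (1 / 3) 3 (1 / 100) (3 / 100) (1 / 2) ϱ (2 / 5) 3 (1 / 3000000) 80 (1 / 100000))
    (hN : LocalSeamReductionR (3 / 5) (1 / 3) 3 (1 / 100) (3 / 100) (1 / 2) ϱ (2 / 5) 3 (1 / 3000000) 80 (1 / 100000) W (1 / 20) 10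
      100000)
    (hP : ChartedChargePricingG (3 / 20) (1 / 10) (3 / 5)) : ChargedEnergyGap :=
  chargedEnergyGap_of_budgetLedger W hF hIP hFCP hCCP hB hLab hSB (farLabelledFloorCoredBudgetW_of_localR hS hN) hP

/-- ★★ **THE MAX-COVER TEN-LEAF RECORD CONE, REPAIRED** at `ϱ = 160` (record-designate of generation 61): `ChargeRecount · IP_G · FCP_G · CCP_G ·
REG-BALL_M · LABEL_M · SHELL-BUDGET_M(10⁵) · LOCAL-TRANSFERʳ(1/(3·10⁶), 10⁻⁵, 80) · LOCAL-REDUCTIONʳ_M · P_G ⟹ ChargedEnergyGap`. -/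
theorem chargedEnergyGap_of_maxCoverLocalLedgerR_record (hF : ChargeRecount)
    (hIP : ImprovablePricingG (3 / 20) (1 / 10) (6 / 5) 10 (1 / 100) (3 / 5))
    (hFCP : FrustratedCorePricingG (3 / 20) (1 / 10) (6 / 5) 10 (1 / 100) 40 (3 / 5))
    (hCCP : CoherentCorePricingG (3 / 20) (1 / 10) (6 / 5) 10 (1 / 100) 40 (1 / 10) 40 (3 / 5))
    (hB : CoreBallRegularPricingW (maxCoverWeights (3 / 20) (1 / 10) (6 / 5) 10 (1 / 100) 40 (1 / 10) 40 160) (1 / 20) (3 / 5) 10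
      fun _ _ => True)
    (hLab : CleanLabellingW (maxCoverWeights (3 / 20) (1 / 10) (6 / 5) 10 (1 / 100) 40 (1 / 10) 40 160) (3 / 5) 10 (1 / 3) 3)
    (hSB : ShellBudgetW (maxCoverWeights (3 / 20) (1 / 10) (6 / 5) 10 (1 / 100) 40 (1 / 10) 40 160) (3 / 5) 100000)
    (hS : LocalSeamTransferBoundR (3 / 5) (1 / 3) 3 (1 / 100) (3 / 100) (1 / 2) 160 (2 / 5) 3 (1 / 3000000) 80 (1 / 100000))
    (hN : LocalSeamReductionR (3 / 5) (1 / 3) 3 (1 / 100) (3 / 100) (1 / 2) 160 (2 / 5) 3 (1 / 3000000) 80 (1 / 100000)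
      (maxCoverWeights (3 / 20) (1 / 10) (6 / 5) 10 (1 / 100) 40 (1 / 10) 40 160) (1 / 20) 10 100000)
    (hP : ChartedChargePricingG (3 / 20) (1 / 10) (3 / 5)) : ChargedEnergyGap :=
  chargedEnergyGap_of_maxCoverBudgetLedger_record hF hIP hFCP hCCP hB hLab hSB (farLabelledFloorCoredBudgetW_of_localR hS hN) hP

/-- ★★ **THE MAX-COVER CREDIT CONE** at `ϱ = 160`, `κ_D = 1/800` (alternative designate, pending census C11-61/χCOST-61): `… · LOCAL-TRANSFER♯ʳ(1/(3·10⁶),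
10⁻⁵, 80, 1/800) · LOCAL-CREDIT-REDUCTIONʳ_M(1/800) · P_G ⟹ ChargedEnergyGap`. -/
theorem chargedEnergyGap_of_maxCoverCreditLedgerR_record (hF : ChargeRecount)
    (hIP : ImprovablePricingG (3 / 20) (1 / 10) (6 / 5) 10 (1 / 100) (3 / 5))
    (hFCP : FrustratedCorePricingG (3 / 20) (1 / 10) (6 / 5) 10 (1 / 100) 40 (3 / 5))
    (hCCP : CoherentCorePricingG (3 / 20) (1 / 10) (6 / 5) 10 (1 / 100) 40 (1 / 10) 40 (3 / 5))
    (hB : CoreBallRegularPricingW (maxCoverWeights (3 / 20) (1 / 10) (6 / 5) 10 (1 / 100) 40 (1 / 10) 40 160) (1 / 20) (3 / 5) 10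
      fun _ _ => True)
    (hLab : CleanLabellingW (maxCoverWeights (3 / 20) (1 / 10) (6 / 5) 10 (1 / 100) 40 (1 / 10) 40 160) (3 / 5) 10 (1 / 3) 3)
    (hSB : ShellBudgetW (maxCoverWeights (3 / 20) (1 / 10) (6 / 5) 10 (1 / 100) 40 (1 / 10) 40 160) (3 / 5) 100000)
    (hS : LocalSeamTransferCreditR (3 / 5) (1 / 3) 3 (1 / 100) (3 / 100) (1 / 2) 160 (2 / 5) 3 (1 / 3000000) 80 (1 / 100000) (1 / 800))
    (hN : LocalSeamCreditReductionR (3 / 5) (1 / 3) 3 (1 / 100) (3 / 100) (1 / 2) 160 (2 / 5) 3 (1 / 3000000) 80 (1 / 100000) (1 / 800)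
      (maxCoverWeights (3 / 20) (1 / 10) (6 / 5) 10 (1 / 100) 40 (1 / 10) 40 160) (1 / 20) 10 100000)
    (hP : ChartedChargePricingG (3 / 20) (1 / 10) (3 / 5)) : ChargedEnergyGap :=
  chargedEnergyGap_of_maxCoverBudgetLedger_record hF hIP hFCP hCCP hB hLab hSB (farLabelledFloorCoredBudgetW_of_creditR hS hN) hP

/-- Consistency: the repaired cone RECOVERS the generation-56 cone (its (H𝄪ʳ) leaf implies (H𝄪), its (N𝄪ʳ) leaf is implied by (N𝄪)). -/
theorem chargedEnergyGap_of_localLedgerR_of_W {ϱ : ℝ} (W : CoreWeights (3 / 20) (1 / 10) (6 / 5) 10 (1 / 100) 40 (1 / 10) 40 ϱ)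
    (hF : ChargeRecount)
    (hIP : ImprovablePricingG (3 / 20) (1 / 10) (6 / 5) 10 (1 / 100) (3 / 5))
    (hFCP : FrustratedCorePricingG (3 / 20) (1 / 10) (6 / 5) 10 (1 / 100) 40 (3 / 5))
    (hCCP : CoherentCorePricingG (3 / 20) (1 / 10) (6 / 5) 10 (1 / 100) 40 (1 / 10) 40 (3 / 5))
    (hB : CoreBallRegularPricingW W (1 / 20) (3 / 5) 10 fun _ _ => True)
    (hLab : CleanLabellingW W (3 / 5) 10 (1 / 3) 3)
    (hSB : ShellBudgetW W (3 / 5) 100000)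
    (hS : LocalSeamTransferBoundR (3 / 5) (1 / 3) 3 (1 / 100) (3 / 100) (1 / 2) ϱ (2 / 5) 3 (1 / 3000000) 80 (1 / 100000))
    (hN : LocalSeamReductionW (3 / 5) (1 / 3) 3 (1 / 100) (3 / 100) (1 / 2) ϱ (2 / 5) 3 (1 / 3000000) 80 (1 / 100000) W (1 / 20) 10
      100000)
    (hP : ChartedChargePricingG (3 / 20) (1 / 10) (3 / 5)) : ChargedEnergyGap :=
  chargedEnergyGap_of_localLedger W hF hIP hFCP hCCP hB hLab hSB (localSeamTransferBoundC_of_R hS) hN hP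

end Record

end Repair

end Summit.AtomisticToContinuum.Crystallization.Theorems.ChargedEnergyGapChartDial

end
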